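/-
Copyright (c) 2026. All rights reserved.
Released under Apache 2.0 license as described in the file LICENSE.
Authors: abc-iut cell, prover seat abc-iut-L4-t5 (gen 9), over abc-iut-w6-d025's product / two-sided setting
(`LogFrobeniusSettingProd.lean`, `LogFrobeniusSettingProdCor55.lean`), abc-iut-f-101's `⊞`-square condition and the
`TS`-observable construction of this seat (`LogFrobeniusObservablesTSOfIotaSquare.lean`).
-/
import Literature.AnabelianGeometry.AbsoluteAnabelian.LogFrobeniusSettingProdCor55
import Literature.AnabelianGeometry.AbsoluteAnabelian.LogFrobeniusObservablesTSOfIotaSquare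
import Literature.AnabelianGeometry.AbsoluteAnabelian.LogFrobeniusNotSimCompatPlusOfObstruction
import Literature.AnabelianGeometry.AbsoluteAnabelian.LogFrobeniusArchGenuineObservables
import Literature.AnabelianGeometry.AbsoluteAnabelian.LogFrobeniusLogWallNonarchModel
import HarnessLib

/-!
# [AbsTopIII] Corollary 5.5 (iii) (both halves) and (iv) (every typed sentence) at the PRODUCT of two settings and at the
# TWO-SIDED genuine setting `genuineTwoSided p 𝔄` — genuine nonarchimedean AND archimedean rows in ONE term

S. Mochizuki, *Topics in absolute anabelian geometry III*, J. Math. Sci. Univ. Tokyo 22 (2015) [MochizukiAbsTopIII2015];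
manuscript `paper:url-5493eb38cbb7`: Def 5.4 (iii) p. 126 ("a commutative diagram"), (v) p. 127, (vii) p. 128, Cor 5.5 (iii)
p. 131 (the observables `S_log⊞`, `S_log` at EVERY `v ∈ V(F_mod)`, archimedean or not), Cor 5.5 (iv) p. 131 (the log-wall;
proof p. 132 l. 43 – p. 133 l. 10 at ONE place of either type), Def 5.4 (i)–(ii) p. 125 (the global objects have a component
at every place).

PROOF-ONLY companion (theorems only; nothing restated) of abc-iut-w6-d025's `LogFrobeniusSetting.prod` /
`genuineTwoSided p 𝔄 := (nonarchGenuineMonoAnPf p).prod (archGenuineMonoAnChart 𝔄)` (p482044: Prop 5.8 (vii) / Cor 5.10 (iv)(a)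
genuine on BOTH place types in one setting — the two-factor proxy of the global theater, honest limits P1–P3 there), which
carried Cor 5.5 (iv) sentence 1 only (`genuineTwoSided_cor55Incompatibility`).  Here, over abc-iut-f-101's `⊞`-square
condition and this seat's `TS`-observable construction:

* `prod_iota_app_fst` / `_snd` — the `ι⊞_{v,ε}` of a product, componentwise; ★ `prod_iotaSquaresCommute` — the `⊞`-square
  condition (Def 5.4 (iii) commutativity transported to the `ι⊞`) is inherited by products, componentwise;
* `prod_cor55Observables`, `prod_cor55ObservablesTS (T)` — hence Cor 5.5 (iii) BOTH halves (F-0142 `S_log⊞`, F-3080 `S_log`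
  for EVERY `TS`-datum) at a product of settings satisfying the square condition;
* `prod_cor55iv_all_of_snd` / `_of_fst` — Cor 5.5 (iv), EVERY typed sentence for EVERY `TS`-datum (`Cor55Incompatibility`,
  `Cor55LogWall T`, `Cor55NotSimultaneouslyCompatible T`) from the archimedean Def 5.4 (v) criterion `k^× ↪ k ∌ 0` on ONE
  factor (this seat's gen-8 `cor55iv_of_iotaPlus_spaceLink_not_surjective`, exactly as abc-iut-w6-d025's
  `prod_cor55Incompatibility_of_snd`);
* at `genuineTwoSided p 𝔄`: `genuineTwoSided_iotaSquaresCommute` (nonarch factor: abc-iut-w4-d095's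
  `nonarchGenuine_iotaSquaresCommute` — print's square at the MLF model; arch factor: `archGenuine_iotaSquaresCommute`),
  ★ `genuineTwoSided_cor55Observables`, ★ `genuineTwoSided_cor55ObservablesTS (T)`, `genuineTwoSided_cor55iv_all`, and
  ★ `genuineTwoSided_cor55iii_iv (v₀ arch) (x₀) (T)` : Cor 5.5 (iii) both halves AND Cor 5.5 (iv) every typed sentence, for
  EVERY `TS`-datum, at ONE setting GENUINE AT BOTH PLACE TYPES (binders: an archimedean place `v₀` and an object `x₀`; zero
  Prop hypotheses) — the label «one place type per setting» (N2) of the Cor5.5(iii)/(iv) model columns is thereby lifted to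
  the two-factor proxy exactly as for Prop5.8(vii)/Cor5.10(iv)(a).

MODEL-LEVEL; honest limits P1–P3 of `LogFrobeniusSettingProd.lean` persist (two-factor proxy of `Th•_T[Z]`, filler slots,
factor limits).  Refereed pre-IUT material; nothing here bears on [IUTchIII] Cor. 3.12; OUR kernel check, no side taken;
non-vacuity ≠ endorsement.
-/

set_option autoImplicit false

open CategoryTheory

universe w u

namespace Literature.AnabelianGeometry.AbsoluteAnabelian

namespace LogFrobeniusSetting

variable {Vmod : Type u} {isArc : Vmod → Bool} (L₁ L₂ : LogFrobeniusSetting Vmod isArc)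

/-! ## `ι⊞_{v,ε}` of a product, componentwise; the square condition is inherited -/

/-- The FIRST component of the product's `ι⊞_{v,ε}` at an object is the first factor's `ι⊞_{v,ε}` (after the identification of
the twisted sources, `frobeniusTwist_prod_comp`). [cite: MochizukiAbsTopIII2015, Def 5.4 (vii) p. 128] -/
theorem prod_iota_app_fst (v : Vmod) {ν₁ ν₂ : LogVertex (isArc v)} (ε : LogEdge (isArc v) ν₁ ν₂) (x : (L₁.prod L₂).X) :
    (((L₁.prod L₂).iota v ε).app x).1 =
      eqToHom (congrArg Prod.fst (Functor.congr_obj (frobeniusTwist_prod_comp L₁ L₂ ν₁.isPostLog v ν₁) x)) ≫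
        (L₁.iota v ε).app x.1 := by
  change ((eqToHom (frobeniusTwist_prod_comp L₁ L₂ _ v _)).app x ≫
    (NatTrans.prod (L₁.iota v ε) (L₂.iota v ε)).app x).1 = _
  rw [prod_comp_fst, eqToHom_app, eqToHom_fst]
  rfl

/-- The SECOND component likewise. [cite: MochizukiAbsTopIII2015, Def 5.4 (vii) p. 128] -/
theorem prod_iota_app_snd (v : Vmod) {ν₁ ν₂ : LogVertex (isArc v)} (ε : LogEdge (isArc v) ν₁ ν₂) (x : (L₁.prod L₂).X) :
    (((L₁.prod L₂).iota v ε).app x).2 =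
      eqToHom (congrArg Prod.snd (Functor.congr_obj (frobeniusTwist_prod_comp L₁ L₂ ν₁.isPostLog v ν₁) x)) ≫
        (L₂.iota v ε).app x.2 := by
  change ((eqToHom (frobeniusTwist_prod_comp L₁ L₂ _ v _)).app x ≫
    (NatTrans.prod (L₁.iota v ε) (L₂.iota v ε)).app x).2 = _
  rw [prod_comp_snd, eqToHom_app, eqToHom_snd]
  rfl

/-- `HEq` of morphisms of a product category passes to the first components. [folklore] -/
private theorem heq_fst_of_heq {C D : Type*} [Category C] [Category D] {A B A' B' : C × D} {m : A ⟶ B} {n : A' ⟶ B'}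
    (hA : A = A') (hB : B = B') (h : HEq m n) : HEq m.1 n.1 := by
  subst hA hB
  rw [eq_of_heq h]

/-- … and to the second components. [folklore] -/
private theorem heq_snd_of_heq {C D : Type*} [Category C] [Category D] {A B A' B' : C × D} {m : A ⟶ B} {n : A' ⟶ B'}
    (hA : A = A') (hB : B = B') (h : HEq m n) : HEq m.2 n.2 := by
  subst hA hB
  rw [eq_of_heq h]

/-- **The `⊞`-square condition is inherited by products**: if the `ι⊞`-squares of `Γ⃗^log_v` commute in both factors
(abc-iut-f-101's `IotaSquaresCommute`), they commute in the product (componentwise).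
[cite: MochizukiAbsTopIII2015, Def 5.4 (iii) p. 126] -/
theorem prod_iotaSquaresCommute (v : Vmod) (h₁ : L₁.IotaSquaresCommute v) (h₂ : L₂.IotaSquaresCommute v) :
    (L₁.prod L₂).IotaSquaresCommute v := by
  intro ν₁ ν₂ ν₂' ν₃ hν₁ hν₂ hν₂' hν₃ ε₁₂ ε₂₃ ε₁₂' ε₂'₃ X₀ m₁₂ m₂₃ m₁₂' m₂'₃ hm₁₂ hm₂₃ hm₁₂' hm₂'₃
  have tA : ∀ {ν : LogVertex (isArc v)}, ν.isPostLog = false →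
      ((L₁.prod L₂).lam v ν).obj X₀ =
        (frobeniusTwist (L₁.prod L₂).log ν.isPostLog ⋙ (L₁.prod L₂).lam v ν).obj X₀ := by
    intro ν hν
    simp [frobeniusTwist, hν]
  have fstH : ∀ {ν ν' : LogVertex (isArc v)} (hν : ν.isPostLog = false) (ε : LogEdge (isArc v) ν ν')
      (m : ((L₁.prod L₂).lam v ν).obj X₀ ⟶ ((L₁.prod L₂).lam v ν').obj X₀),
      HEq m (((L₁.prod L₂).iota v ε).app X₀) → HEq m.1 ((L₁.iota v ε).app X₀.1) := by
    intro ν ν' hν ε m hm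
    have h := heq_fst_of_heq (tA hν) rfl hm
    rw [prod_iota_app_fst] at h
    exact (heq_eqToHom_comp_iff _ _ _).mp h
  have sndH : ∀ {ν ν' : LogVertex (isArc v)} (hν : ν.isPostLog = false) (ε : LogEdge (isArc v) ν ν')
      (m : ((L₁.prod L₂).lam v ν).obj X₀ ⟶ ((L₁.prod L₂).lam v ν').obj X₀),
      HEq m (((L₁.prod L₂).iota v ε).app X₀) → HEq m.2 ((L₂.iota v ε).app X₀.2) := by
    intro ν ν' hν ε m hm
    have h := heq_snd_of_heq (tA hν) rfl hm
    rw [prod_iota_app_snd] at h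
    exact (heq_eqToHom_comp_iff _ _ _).mp h
  apply Prod.hom_ext
  · exact h₁ hν₁ hν₂ hν₂' hν₃ ε₁₂ ε₂₃ ε₁₂' ε₂'₃ X₀.1 m₁₂.1 m₂₃.1 m₁₂'.1 m₂'₃.1 (fstH hν₁ ε₁₂ m₁₂ hm₁₂)
      (fstH hν₂ ε₂₃ m₂₃ hm₂₃) (fstH hν₁ ε₁₂' m₁₂' hm₁₂') (fstH hν₂' ε₂'₃ m₂'₃ hm₂'₃)
  · exact h₂ hν₁ hν₂ hν₂' hν₃ ε₁₂ ε₂₃ ε₁₂' ε₂'₃ X₀.2 m₁₂.2 m₂₃.2 m₁₂'.2 m₂'₃.2 (sndH hν₁ ε₁₂ m₁₂ hm₁₂)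
      (sndH hν₂ ε₂₃ m₂₃ hm₂₃) (sndH hν₁ ε₁₂' m₁₂' hm₁₂') (sndH hν₂' ε₂'₃ m₂'₃ hm₂'₃)

/-! ## Cor 5.5 (iii) (both halves) and (iv) (every typed sentence) at a product -/

/-- **Cor 5.5 (iii), `⊞`-half (F-0142), at a product** of settings whose `ι⊞`-squares commute at every place.
[cite: MochizukiAbsTopIII2015, Cor 5.5 (iii) p. 131] -/
theorem prod_cor55Observables (h₁ : ∀ v, L₁.IotaSquaresCommute v) (h₂ : ∀ v, L₂.IotaSquaresCommute v) :
    (L₁.prod L₂).Cor55Observables :=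
  (L₁.prod L₂).cor55Observables_of_iotaSquaresCommute fun v => prod_iotaSquaresCommute L₁ L₂ v (h₁ v) (h₂ v)

/-- **Cor 5.5 (iii), `TS`-half (F-3080), at such a product, for EVERY `TS`-datum.** [cite: MochizukiAbsTopIII2015, Cor 5.5 (iii) p. 131] -/
theorem prod_cor55ObservablesTS (h₁ : ∀ v, L₁.IotaSquaresCommute v) (h₂ : ∀ v, L₂.IotaSquaresCommute v)
    (T : (L₁.prod L₂).TSHomotopies) : (L₁.prod L₂).Cor55ObservablesTS T :=
  (L₁.prod L₂).cor55ObservablesTS_of_iotaSquaresCommute T fun v => prod_iotaSquaresCommute L₁ L₂ v (h₁ v) (h₂ v)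

/-- **Cor 5.5 (iv), EVERY typed sentence for EVERY `TS`-datum, at a product from the archimedean criterion on the SECOND
factor**: if under a set-valued functor `Φ₂` on `𝒩⊞_{v₀}` of `L₂` every `ι⊞`-edge into the space-link vertex at the
archimedean place `v₀` is non-surjective at `x₀.2` (Def 5.4 (v): `k^× ↪ k ∌ 0`), then the product has
`Cor55Incompatibility`, and `Cor55LogWall T`, `Cor55NotSimultaneouslyCompatible T` for every `T`.
[cite: MochizukiAbsTopIII2015, Cor 5.5 (iv) p. 131] -/
theorem prod_cor55iv_all_of_snd (v₀ : Vmod) (hv₀ : isArc v₀ = true) (x₀ : (L₁.prod L₂).X)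
    (Φ₂ : L₂.Nplus v₀ ⥤ Type w)
    (hΦ : ∀ (ν : LogVertex (isArc v₀)), ν.isPostLog = false →
      ∀ ε : LogEdge (isArc v₀) ν (LogVertex.spaceLink (isArc v₀)),
        ¬ Function.Surjective (Φ₂.map ((L₂.iota v₀ ε).app x₀.2) : _ → _)) :
    (L₁.prod L₂).Cor55Incompatibility ∧ ∀ T : (L₁.prod L₂).TSHomotopies,
      (L₁.prod L₂).Cor55LogWall T ∧ (L₁.prod L₂).Cor55NotSimultaneouslyCompatible T :=
  (L₁.prod L₂).cor55iv_of_iotaPlus_spaceLink_not_surjective v₀ hv₀ x₀ (CategoryTheory.Prod.snd _ _ ⋙ Φ₂)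
    fun ν hν ε hsurj => hΦ ν hν ε fun z => by
      obtain ⟨a, ha⟩ := hsurj z
      exact ⟨_, (prod_snd_map_iota_app_apply L₁ L₂ v₀ ε x₀ Φ₂ a).symm.trans ha⟩

/-- The same from the criterion on the FIRST factor. [cite: MochizukiAbsTopIII2015, Cor 5.5 (iv) p. 131] -/
theorem prod_cor55iv_all_of_fst (v₀ : Vmod) (hv₀ : isArc v₀ = true) (x₀ : (L₁.prod L₂).X)
    (Φ₁ : L₁.Nplus v₀ ⥤ Type w)
    (hΦ : ∀ (ν : LogVertex (isArc v₀)), ν.isPostLog = false →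
      ∀ ε : LogEdge (isArc v₀) ν (LogVertex.spaceLink (isArc v₀)),
        ¬ Function.Surjective (Φ₁.map ((L₁.iota v₀ ε).app x₀.1) : _ → _)) :
    (L₁.prod L₂).Cor55Incompatibility ∧ ∀ T : (L₁.prod L₂).TSHomotopies,
      (L₁.prod L₂).Cor55LogWall T ∧ (L₁.prod L₂).Cor55NotSimultaneouslyCompatible T :=
  (L₁.prod L₂).cor55iv_of_iotaPlus_spaceLink_not_surjective v₀ hv₀ x₀ (CategoryTheory.Prod.fst _ _ ⋙ Φ₁)
    fun ν hν ε hsurj => hΦ ν hν ε fun z => by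
      obtain ⟨a, ha⟩ := hsurj z
      exact ⟨_, (prod_fst_map_iota_app_apply L₁ L₂ v₀ ε x₀ Φ₁ a).symm.trans ha⟩

/-! ## At the two-sided genuine setting `genuineTwoSided p 𝔄` -/

section TwoSided

variable (p : ℕ) [Fact p.Prime] (𝔄 : AutHolFieldFunctor.{0}) (Vmod : Type 1) (isArc : Vmod → Bool)

/-- The `ι⊞`-squares commute at every place of the nonarchimedean factor `nonarchGenuineMonoAnPf p` (same holomorphic rows
as abc-iut-w4-d095's `nonarchGenuine p`: `nonarchGenuine_iotaSquaresCommute`, print's Def 5.4 (iii) square at the MLF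
model). [cite: MochizukiAbsTopIII2015, Def 5.4 (iii) p. 126] -/
theorem nonarchGenuineMonoAnPf_iotaSquaresCommute (v : Vmod) :
    (nonarchGenuineMonoAnPf p Vmod isArc).IotaSquaresCommute v :=
  nonarchGenuine_iotaSquaresCommute p Vmod isArc v

/-- The `ι⊞`-squares commute at every place of the archimedean factor `archGenuineMonoAnChart 𝔄` (same holomorphic rows as
`archGenuine 𝔄`: `archGenuine_iotaSquaresCommute`). [cite: MochizukiAbsTopIII2015, Def 5.4 (v) p. 127] -/
theorem archGenuineMonoAnChart_iotaSquaresCommute (v : Vmod) :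
    (archGenuineMonoAnChart 𝔄 Vmod isArc).IotaSquaresCommute v :=
  archGenuine_iotaSquaresCommute 𝔄 Vmod isArc v

/-- **The `ι⊞`-squares commute at EVERY place of the two-sided genuine setting.** [cite: MochizukiAbsTopIII2015, Def 5.4 (iii) p. 126] -/
theorem genuineTwoSided_iotaSquaresCommute (v : Vmod) : (genuineTwoSided p 𝔄 Vmod isArc).IotaSquaresCommute v :=
  prod_iotaSquaresCommute _ _ v (nonarchGenuineMonoAnPf_iotaSquaresCommute p Vmod isArc v)
    (archGenuineMonoAnChart_iotaSquaresCommute 𝔄 Vmod isArc v)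

/-- **[AbsTopIII] Cor 5.5 (iii), `⊞`-half (F-0142 `Cor55Observables`), HOLDS at the two-sided genuine setting** — genuine
nonarchimedean AND archimedean rows in one term; zero hypotheses. [cite: MochizukiAbsTopIII2015, Cor 5.5 (iii) p. 131] -/
theorem genuineTwoSided_cor55Observables : (genuineTwoSided p 𝔄 Vmod isArc).Cor55Observables :=
  (genuineTwoSided p 𝔄 Vmod isArc).cor55Observables_of_iotaSquaresCommute
    (genuineTwoSided_iotaSquaresCommute p 𝔄 Vmod isArc)

/-- **[AbsTopIII] Cor 5.5 (iii), `TS`-half (F-3080 `Cor55ObservablesTS`), HOLDS at the two-sided genuine setting for EVERY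
`TS`-datum.** [cite: MochizukiAbsTopIII2015, Cor 5.5 (iii) p. 131] -/
theorem genuineTwoSided_cor55ObservablesTS (T : (genuineTwoSided p 𝔄 Vmod isArc).TSHomotopies) :
    (genuineTwoSided p 𝔄 Vmod isArc).Cor55ObservablesTS T :=
  (genuineTwoSided p 𝔄 Vmod isArc).cor55ObservablesTS_of_iotaSquaresCommute T
    (genuineTwoSided_iotaSquaresCommute p 𝔄 Vmod isArc)

/-- **[AbsTopIII] Cor 5.5 (iv), EVERY typed sentence for EVERY `TS`-datum, HOLDS at the two-sided genuine setting** over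
every index set with an archimedean place `v₀` and every object `x₀ = (A, (𝕏 ↶ M))`: the archimedean factor's `ι⊞` along
`k^× ↪ k` misses `0` (abc-iut-w4-d095's `forget_archIota_spaceLink_not_surjective`; print's Lemma 4.4 mechanism at ONE place).
[cite: MochizukiAbsTopIII2015, Cor 5.5 (iv) p. 131] -/
theorem genuineTwoSided_cor55iv_all (v₀ : Vmod) (hv₀ : isArc v₀ = true) (x₀ : (genuineTwoSided p 𝔄 Vmod isArc).X) :
    (genuineTwoSided p 𝔄 Vmod isArc).Cor55Incompatibility ∧ ∀ T : (genuineTwoSided p 𝔄 Vmod isArc).TSHomotopies,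
      (genuineTwoSided p 𝔄 Vmod isArc).Cor55LogWall T ∧
        (genuineTwoSided p 𝔄 Vmod isArc).Cor55NotSimultaneouslyCompatible T :=
  prod_cor55iv_all_of_snd _ _ v₀ hv₀ x₀ (inducedFunctor _ ⋙ HolTHPair.forget 𝔄)
    (fun ν _ ε => forget_archIota_spaceLink_not_surjective 𝔄 (isArc v₀) hv₀ ν ε x₀.2)

/-- ★ **Cor 5.5 (iii) (both halves) AND Cor 5.5 (iv) (every typed sentence), for EVERY `TS`-datum, at ONE setting GENUINE AT
BOTH PLACE TYPES** (binders: an archimedean place `v₀`, an object `x₀`; zero Prop hypotheses): the observables `S_log⊞`,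
`S_log` EXIST and the log-wall holds against them.  MODEL-LEVEL (two-factor proxy of the global theater).
[cite: MochizukiAbsTopIII2015, Cor 5.5 (iv) p. 131] -/
theorem genuineTwoSided_cor55iii_iv (v₀ : Vmod) (hv₀ : isArc v₀ = true) (x₀ : (genuineTwoSided p 𝔄 Vmod isArc).X)
    (T : (genuineTwoSided p 𝔄 Vmod isArc).TSHomotopies) :
    (genuineTwoSided p 𝔄 Vmod isArc).Cor55Observables ∧ (genuineTwoSided p 𝔄 Vmod isArc).Cor55ObservablesTS T ∧
      (genuineTwoSided p 𝔄 Vmod isArc).Cor55Incompatibility ∧ (genuineTwoSided p 𝔄 Vmod isArc).Cor55LogWall T ∧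
      (genuineTwoSided p 𝔄 Vmod isArc).Cor55NotSimultaneouslyCompatible T :=
  ⟨genuineTwoSided_cor55Observables p 𝔄 Vmod isArc, genuineTwoSided_cor55ObservablesTS p 𝔄 Vmod isArc T,
    (genuineTwoSided_cor55iv_all p 𝔄 Vmod isArc v₀ hv₀ x₀).1,
    (genuineTwoSided_cor55iv_all p 𝔄 Vmod isArc v₀ hv₀ x₀).2 T⟩

/-- Existence form: a §5 setting genuine at BOTH place types, on the carrier `𝒞^{MLF}_p × 𝒞^hol_TF`, at which — for every
`TS`-datum — the observables `S_log⊞`, `S_log` exist and every typed sentence of Cor 5.5 (iv) holds, whenever there is an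
archimedean place and an object. [cite: MochizukiAbsTopIII2015, Cor 5.5 (iv) p. 131] -/
theorem exists_genuineTwoSided_cor55iii_iv (v₀ : Vmod) (hv₀ : isArc v₀ = true)
    (x₀ : Up (AbsTopIII.TFModel p) × Up (HolTFPair 𝔄)) :
    ∃ L : LogFrobeniusSetting Vmod isArc, L.X = (Up (AbsTopIII.TFModel p) × Up (HolTFPair 𝔄)) ∧
      ∀ T : L.TSHomotopies, L.Cor55Observables ∧ L.Cor55ObservablesTS T ∧ L.Cor55Incompatibility ∧ L.Cor55LogWall T ∧
        L.Cor55NotSimultaneouslyCompatible T :=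
  ⟨genuineTwoSided p 𝔄 Vmod isArc, rfl, genuineTwoSided_cor55iii_iv p 𝔄 Vmod isArc v₀ hv₀ x₀⟩

end TwoSided

end LogFrobeniusSetting

end Literature.AnabelianGeometry.AbsoluteAnabelian
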